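import Summits.Ventures.Crystal3D.Theorems.StickyWulffConstantGenericWallFloorEndBallMenuDefs
import HarnessLib

/-!
# THE §51 INTERFACE (definitions): an end-ball class `(contacts, own)` in integer cubic coordinates and its computable FREE SITES
# (crux `GenericWallFloor`, stmt-Ventures-19480, line `WallLedgerG`; cf-p1 RULINGS 2026-08-28T21:18:47Z (i)–(iii) + «one-screen §51 interface»)

HONEST FRAMING. Venture `Summits/Ventures/Crystal3D` (cell `crystal3d-full`), helper vocabulary for the crux `GenericWallFloor` of
`route-Ventures-StickyWulffConstant`, REGISTERED line `WallLedgerG`, open stub `stub_twoSlabAdhesion`.  DEFINITIONS ONLY (computable: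
`EndBallClass`, `wf`, `listed`, `overlaps`, `freeSites`, `slotIdx`, and the carrier predicate `IsCarrier`); the consuming theorems
(`EndBallClass.universe_sharp/_count`, soundness of the verdicts) are the sequel `…GenericWallFloorEndBallClassInterface`.  Nothing is
claimed about packings here; F-C1 not moved.

## THE §51 INTERFACE (one screen; for cf-p2's enumeration and the per-class kernel glue)

CURRENCY. Integer triples `q : Fin 3 → ℤ` = relative positions `z + A (pointVec q)` around the end ball `z`, in the cubic frame of
the class's ANCHOR LATTICE `A` (cubic coordinates `q/(3√2)`; squared distance `sdot3 q q / 18`; the twelve slots are `3 • slotInt i`,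
`dozenQ3 none`).  A class anchored in the twin lattice of a Σ3 pair is presented in THAT lattice's frame (apply the integer reflection
`q ↦ q − (2(q⬝c)/3) c` to the T-presentation; integral on CSL-compatible data).
INPUT, per class `C : EndBallClass`:  `C.contacts` — the certified contact slots of `z` (distinct elements of `dozenQ3 none`;
`C.wf = true`, decidable);  `C.own` — the other certified balls (any `q`);  and the certified SHELL ROW in sharp form
`deg z ≤ C.contacts.length` (cf-p2's cube-map certificate `ShellRowHolds`, …ShellRowCertBridgeB) — or only the COUNT form
`deg z ≤ C.contacts.length + 1` (then use `sharp := false`).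
VERDICTS per site `q ∈ menuQ3`, `sdot3 q q ≤ 54` (the 147-site universe of record, cf-p1 (i)), all DECIDABLE from `(contacts, own)`:
`centre` (`q = 0`) · `listed` (`q ∈ contacts ∪ own`) · `overlap` (`sdot3 q q < 18`, or `sdot3 (q − p) (q − p) < 18` for a listed
`p ≠ q`: no ball can sit there, `1`-separation) · `extraContact` (`sdot3 q q = 18`, unlisted: excluded by the SHARP shell row) ·
`free` (everything else) = `C.freeSites sharp` (computable `Finset`; per class it is EVALUATED — `decide +kernel`, ≈ 50 s dominated by
`menuQ3`'s deduplication, or `native_decide` in the computational-grade class files that already carry the `shellCover_Gk` certificates).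
OUTPUT (kernel, `EndBallClass.universe_sharp` / `_count` of …EndBallClassInterface): GAP/CLASS (`δ ≥ 5/2`), `X` `1`-separated, `z` a CARRIER of `C` in frame `A`
(`C.IsCarrier X A z`: the listed balls are present), shell row as above.  Then every `x ∈ X` with `dist x z ≤ √3` is: `z` itself, OR a
listed ball `z + A·pointVec q` (`q ∈ contacts ∪ own`), OR a ball at a FREE site `z + A·pointVec q`, `q ∈ C.freeSites sharp`, OR
PAYER-ACCOMPANIED: some `y ∈ X`, `y ≠ z`, `dist x y ≤ 2` (so `dist z y ≤ 2 + √3`) with `deg y ≤ 11` — the branch of the OFF-MENU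
balls (cf-p1 (ii): class balls off the menu, e.g. the riser-step balls at `2/√3`, are never enumerated; they are paid for, with the
multiplicity constants `≤ 125 / ≤ 606 / 1212·D(X)` of …PayerMultiplicity / …EndBallPayerBound).
SO cf-p2's §51 OUTPUT per class is literally: `(contacts, own, bound)` + for each `q ∈ C.freeSites true` a ROW `(class, site q, verdict)`
with verdict ∈ {`occupied ⇒ class C′` (the enumeration recurses on the bigger class), `empty in every completion` (a certificate row),
`payer-only`}; the kernel reproduces `freeSites` by `decide` and consumes the rows class by class.  COUNT THRESHOLD of record (cf-p1
(iii)): `deg z ≤ |contacts| + 1`; `deg z = |contacts| + 2` is the registered k-residual boundary.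
WHAT THIS IS NOT: no class is enumerated or certified here; F-C1 not moved.
-/

namespace Summit.Ventures.Crystal3D.Theorems

open Summit.Ventures.Crystal3D Finset NearIdentity
open scoped InnerProductSpace

/-! ### §1 The interface objects (computable) -/

/-- **A §51 end-ball class** in the cubic frame of its anchor lattice: the certified contact slots of the end ball and the other
certified balls, as integer triples `q` (relative position `z + A (pointVec q)`). -/
structure EndBallClass where
  /-- certified contacts of the end ball: distinct slots `3 • slotInt i` (elements of `dozenQ3 none`) -/
  contacts : List (Fin 3 → ℤ)
  /-- the other certified balls of the class (non-contacts; any integer triples) -/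
  own : List (Fin 3 → ℤ)

/-- Well-formedness (decidable): the contacts are pairwise distinct slots. -/
def EndBallClass.wf (C : EndBallClass) : Bool :=
  (C.contacts.all fun q => decide (q ∈ dozenQ3 none)) && decide C.contacts.Nodup

/-- The listed balls of the class (contacts and own balls). -/
def EndBallClass.listed (C : EndBallClass) : List (Fin 3 → ℤ) := C.contacts ++ C.own

/-- Verdict `overlap` at a site `q`: a ball at `z + A·pointVec q` would be closer than `1` to the centre or to a listed ball. -/
def EndBallClass.overlaps (C : EndBallClass) (q : Fin 3 → ℤ) : Bool :=
  decide (sdot3 q q < 18) || C.listed.any fun p => decide (p ≠ q ∧ sdot3 (q - p) (q - p) < 18)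

/-- **The FREE SITES of a class** (computable): the menu sites within `√3` that are not the centre, not listed, not overlapping, and —
when `sharp` (the certified shell row is `deg z ≤ |contacts|`) — not an extra contact (`sdot3 q q = 18`). -/
def EndBallClass.freeSites (C : EndBallClass) (sharp : Bool) : Finset (Fin 3 → ℤ) :=
  menuQ3.filter fun q => sdot3 q q ≤ 54 ∧ q ≠ 0 ∧ q ∉ C.listed ∧ C.overlaps q = false ∧ (sharp = true → sdot3 q q ≠ 18)

/-- `z` CARRIES the class `C` in the frame `A` inside `X`: `z ∈ X` and every listed ball `z + A (pointVec q)` is in `X`. -/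
def EndBallClass.IsCarrier (C : EndBallClass) (X : Finset (EuclideanSpace ℝ (Fin 3)))
    (A : EuclideanSpace ℝ (Fin 3) ≃ₗᵢ[ℝ] EuclideanSpace ℝ (Fin 3)) (z : EuclideanSpace ℝ (Fin 3)) : Prop :=
  z ∈ X ∧ ∀ q ∈ C.listed, z + A (pointVec q) ∈ X

/-- The slot indices of the contact list. -/
def EndBallClass.slotIdx (C : EndBallClass) : Finset (Fin 12) :=
  Finset.univ.filter fun i => 3 • slotInt i ∈ C.contacts

end Summit.Ventures.Crystal3D.Theorems
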